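import Summits.QuantumFields.BalabanUV.Beta.KernelWardHColumnFixed
import Summits.QuantumFields.BalabanUV.Beta.RelInvSymBorderedHessianStep

/-!
# `BalabanUV.Beta.KernelWardHColumnSym` — binder row D1, SYMMETRISED literal «JsB12Sym», hW class: THE ℋ-COLUMN WARD LAW OF THE SYMMETRISED
# CO-DRESSED STEP RESOLVENTS `G_j := coDressKSymAt ρ_c Lc (KInvStep Lc j)` AT EVERY STEP `j`, constant `cH j = (stepScale d Lc j · Lc^{d+1})⁻¹` —
# the socket `hH` of `KernelWardSymEnd` ∕ `RowD1JointEndSym` §3–§5 DISCHARGED (literal-independent)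

HONEST FRAMING (cell charter, verbatim): «discharging BetaPertH makes Balaban's UV stability UNCONDITIONAL — a real constructive-QFT result; it is
NOT the continuum limit and NOT the Clay problem.»  HONEST DEPENDENCY: continuum YM on T⁴ ⇐ BetaPertH ∧ nine spine estimates (0/9 proved);
BetaPertH ⇐ (D1) ∧ (D4) ∧ CAP+tail; G-an2-4 gates asym, D1 and NE2/3/4.
DERIVED cell leaf (β sub-cell, BINDER-OWNERS row D1 OWNER `b2b-balaban-beta-an2`, gen 27; RULING R-D1-g27-2, see `KernelWardHColumnFixed`).  No statement of
Bałaban's papers, no `[cite:]`, no `Prop` fact, no `def`.  Discharges NO binder of the wall by itself: it turns ONE displayed hypothesis (`hH`, with its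
constants `cH j`) of the row's END `RowD1JointEndSym.d1Drift_dressSymCtr_of_letters_bhKStep_symEc_D1Tel_D1Rep` into a theorem; the hW LETTERS
(St)(Wt)(Sd)(Wd) of the undressed literal, the hR letters, `hcomp`, `D1Tel`, `D1Rep` remain.  NOT D1, NOT `BetaPertH`, NOT continuum, NOT Clay.
WHAT ([folklore] kernel bookkeeping; «not in print; our proof attempt»).  §3 **`comp_symEc_pgTest`**: the symmetrised slice projector `symEc N`
(`SymSliceProjectorKernel`) FIXES the pure-gauge test kernel `KernelWardHColumnFixed.pgTest N y` — its face-crossing field rows are the identity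
(`SymSliceProjectorRules.comp_symEc_apply_inl_of_not_int`), its interior field rows read only interior bonds of one block, on which the pure gauge of a
block indicator vanishes (`comp_symEc_apply_inl_of_int` + `blk_add_unitVec_of_isIntBond`), its multiplier rows see `0`.  §4
**`colH_ward_coDressKSymAt_KInvStep`**: `Σ_μ (colH G_j Lc μ (y − e_μ) κ′ u − colH G_j Lc μ y κ′ u) = (stepScale d Lc j · Lc^{d+1})⁻¹ · gaugeWt Lc y κ′ u`
for `G_j := coDressKSymAt (ctr (d+1) Lc) Lc (KInvStep Lc j)`, EVERY `j`, EVERY `d`, `Lc ≥ 1` — from `KernelWardHColumnFixed.colH_ward_of_AME_all_fix`,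
`RelInvSymBorderedHessianStep.relInv_coDressKSymAt_KInvStep_bhKStep` (rule AME against `bhKStep d Lc j` ∕ `symEc Lc`) and §3 (at `d = 3`, `j = 0`:
`cH 0 = Lc⁻⁴`, as for the comb).  Provenance: β sub-cell, unit beta-an2 gen 27, 2026-08-21 (v1); over `KernelWardHColumnFixed` (this gen),
`SymSliceProjector{Kernel,Rules,Spread}`, `SymmetrisedDressingKernel`, `RelInvSymBorderedHessianStep` (an2 gen 25∕26) BY NAME; no existing file touched.
-/

open Finset
open scoped BigOperators
open Literature.Probability.LatticeModels (TorusSite Torus.proj Torus.proj_apply)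
open Literature.MathematicalPhysics.QuantumFieldTheory
open Literature.MathematicalPhysics.QuantumFieldTheory.Balaban1983to89
open Literature.MathematicalPhysics.QuantumFieldTheory.Balaban1983to89.Beta
open ExpKernelCalculus (MKer comp)
open AffineAveraging (Form0 Form1 box toSite)
open AveragingContours (blk blk_block off off_mem_box blk_add_off)
open AveragingContoursRooted (ctr ctrOff ctrOff_mem_box)
open OneStepResolventKernel (Fib)
open OneStepKernelFamily (KInvStep colH)
open Summit.QuantumFields.BalabanUV.Beta.TameKernelCalculus
open Summit.QuantumFields.BalabanUV.Beta.ChartConjugationRelative (RelInv)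
open Summit.QuantumFields.BalabanUV.Beta.AxialDressingRooted (one_le_of_neZero)
open Summit.QuantumFields.BalabanUV.Beta.BorderedHessian (bhKStep spr_KInvStep stepScale)
open Summit.QuantumFields.BalabanUV.Beta.KernelWardRelative (gaugeWt)
open Summit.QuantumFields.BalabanUV.Beta.KernelWardHColumnFixed (blockInd_apply pgTest pgTest_inl pgTest_inr colH_ward_of_AME_all_fix)
open Summit.QuantumFields.BalabanUV.Beta.SymSliceBlockMatrix (BIdx bIdxSet mem_bIdxSet Pmat)
open Summit.QuantumFields.BalabanUV.Beta.SymSliceProjectorKernel (symEc IsIntBond)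
open Summit.QuantumFields.BalabanUV.Beta.SymSliceProjectorRules (comp_symEc_apply_inr comp_symEc_apply_inl_of_not_int comp_symEc_apply_inl_of_int)
open Summit.QuantumFields.BalabanUV.Beta.SymSliceProjectorSpread (spr_symEc)
open Summit.QuantumFields.BalabanUV.Beta.SymmetrisedDressingKernel (coDressKSymAt spr_coDressKSymAt)
open Summit.QuantumFields.BalabanUV.Beta.RelInvSymBorderedHessianStep (relInv_coDressKSymAt_KInvStep_bhKStep)

namespace Summit.QuantumFields.BalabanUV.Beta.KernelWardHColumnSym

noncomputable section

variable {d : ℕ}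

/-! ## §3 The symmetrised slice projector fixes the test kernel -/

section SymFix

variable {N : ℕ}

/-- [folklore] A box offset stepped inside the box along `γ` stays in the block: `blk (N•q + b + e_γ) = q` when `b_γ + 1 < N`. -/
theorem blk_zsmul_add_toSite_add_unitVec {q : Fin (d + 1) → ℤ} {b : Fin (d + 1) → ℕ} (hb : b ∈ box (d + 1) N) {γ : Fin (d + 1)}
    (hγ : b γ + 1 < N) : blk N ((N : ℤ) • q + toSite b + AffineAveraging.unitVec γ) = q := by
  have hb' : ∀ i, b i < N := by simpa [AffineAveraging.box, Fintype.mem_piFinset, Finset.mem_range] using hb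
  set b' : Fin (d + 1) → ℕ := fun i => if i = γ then b i + 1 else b i with hb'def
  have hmem : b' ∈ box (d + 1) N := by
    simp only [AffineAveraging.box, Fintype.mem_piFinset, Finset.mem_range, hb'def]
    intro i
    split_ifs with hi
    · rw [hi]; exact hγ
    · exact hb' i
  have e : (N : ℤ) • q + toSite b + AffineAveraging.unitVec γ = (N : ℤ) • q + toSite b' := by
    funext i
    simp only [Pi.add_apply, toSite, AffineAveraging.unitVec_apply, hb'def]
    split_ifs with hi
    · push_cast; ring
    · ring
  rw [e, blk_block q hmem]

/-- [folklore] **AN INTERIOR BOND DOES NOT LEAVE ITS BLOCK**: `IsIntBond N α x → blk (x + e_α) = blk x`. -/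
theorem blk_add_unitVec_of_isIntBond (hN : 1 ≤ N) {α : Fin (d + 1)} {x : Fin (d + 1) → ℤ} (h : IsIntBond N α x) :
    blk N (x + AffineAveraging.unitVec α) = blk N x := by
  have hm := mem_bIdxSet.1 h
  conv_lhs => rw [← blk_add_off hN x]
  exact blk_zsmul_add_toSite_add_unitVec hm.1 hm.2

/-- [folklore] **`symEc` FIXES THE PURE-GAUGE TEST KERNEL**: `symEc N ∘ pgTest N y = pgTest N y` — face-crossing field rows are the identity,
interior field rows read only interior bonds of one block (where the pure gauge of a block indicator vanishes), multiplier rows see `0`. -/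
theorem comp_symEc_pgTest (hN : 1 ≤ N) (y : Fin (d + 1) → ℤ) : comp (symEc N) (pgTest N y) = pgTest (d := d) N y := by
  funext z z' a b
  rcases a with α | m
  · by_cases hα : IsIntBond N α z
    · rw [comp_symEc_apply_inl_of_int hN _ hα]
      have hz : pgTest N y z z' (Sum.inl α) b = 0 := by
        rw [pgTest_inl, blockInd_apply, blockInd_apply, blk_add_unitVec_of_isIntBond hN hα, sub_self]
        split_ifs <;> rfl
      rw [hz]
      refine Finset.sum_eq_zero fun j _ => ?_
      have hj := mem_bIdxSet.1 j.2
      rw [pgTest_inl, blockInd_apply, blockInd_apply, blk_zsmul_add_toSite_add_unitVec hj.1 hj.2, blk_block (blk N z) hj.1, sub_self]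
      split_ifs <;> simp
    · exact comp_symEc_apply_inl_of_not_int _ hα _ _
  · rw [comp_symEc_apply_inr, pgTest_inr]
    split_ifs <;> rfl

end SymFix

/-! ## §4 The instance of record: the symmetrised co-dressed step resolvents, every step -/

section Instance

variable {Lc : ℕ} [NeZero Lc]

/-- [folklore] **THE ℋ-COLUMN WARD LAW OF `G_j := coDressKSymAt ρ_c Lc (KInvStep Lc j)` AT EVERY STEP** — the socket `hH` of the (0.4) root with
`cH j = (stepScale d Lc j · Lc^{d+1})⁻¹`: from `RelInvSymBorderedHessianStep.relInv_coDressKSymAt_KInvStep_bhKStep` (rule AME against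
`bhKStep d Lc j` and `symEc Lc`) and §3. -/
theorem colH_ward_coDressKSymAt_KInvStep (j : ℕ) (y : Fin (d + 1) → ℤ) (κ' : Fin (d + 1)) (u : Fin (d + 1) → ℤ) :
    ∑ μ, (colH (coDressKSymAt (ctr (d + 1) Lc) Lc (KInvStep (d := d) Lc j)) Lc μ (y - B6BondElimination.unitVec μ) κ' u
        - colH (coDressKSymAt (ctr (d + 1) Lc) Lc (KInvStep (d := d) Lc j)) Lc μ y κ' u) =
      (stepScale d Lc j * (Lc : ℝ) ^ (d + 1))⁻¹ * gaugeWt Lc y κ' u := by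
  have hLc : 1 ≤ Lc := one_le_of_neZero Lc
  have hr : ctrOff (d + 1) Lc ∈ box (d + 1) Lc := ctrOff_mem_box hLc
  have hG : ∀ j, Spr (coDressKSymAt (ctr (d + 1) Lc) Lc (KInvStep (d := d) Lc j)) := fun j =>
    spr_coDressKSymAt hLc hr (spr_KInvStep j)
  exact colH_ward_of_AME_all_fix (E := symEc Lc) hG (spr_symEc hLc) (fun j => (relInv_coDressKSymAt_KInvStep_bhKStep j).AME)
    (comp_symEc_pgTest hLc) j y κ' u

end Instance

end

end Summit.QuantumFields.BalabanUV.Beta.KernelWardHColumnSym
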